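import Literature.MathematicalPhysics.QuantumFieldTheory.Balaban1983to89.B1Eq324BenfattoSect5LedgerDischarge
import HarnessLib

/-!
# `Balaban1983to89.B1Eq324BenfattoKernelSect5LedgerPerBox` — [BenfattoEtAl1978] p. 152 (4.7), (5.19)–(5.31) p. 156–158, p. 159 «Collecting all the
# errors», for the class of [Balaban1985BackgroundPropagators] Sect. E p. 428: the per-box error of the CLASS pavement step
# (`…KernelSect5StepBound.exists_lower_step`, `Err = closed`) ATOM BY ATOM in the ledger's currency, with the class letters `K₀`, `K_u`, `ε₃₁`, `|□′|`
# as displayed rows — PROVED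

statement-level skeleton of published theorems with citation tags; proofs where landed; nothing here is a claim about the
Yang–Mills mass gap

WHY THIS MODULE (cell `pub-ymgap`, seat `dag-n08-b` gen 13; node N08 [Balaban1985UV3]; own lineage = `…Sect5LedgerDischarge` §4).  The per-box error
of print's step (`…Sect5PerBoxErrBound.perBoxErr_le`) was absorbed atom by atom in `…Sect5LedgerDischarge` §4 at print's letters: the centre bound
`(1 + 2d/α²)·γc`, the propagator constant `max(max 1 C₀₀, …)`, the (5.31) error `max(β·2d·C₀₀θ^{w−v}·γc·L^d(1+√d(L−1)), 2dC₀₀θ^{w−v}/α²)`.  The class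
edition of the step (seat n08-c's `…KernelSect5StepBound.exists_lower_step`, conj 3 `Err m = …`) displays instead the LETTERS `K_u` (centre bound on
`I`), `K₀ ≥ 1` (propagator size), `ε₃₁ ≥ 0` ((5.31) legs at depth `w − v`) and keeps the true volume `|□′| = |shrink L m w|`; atoms (g) remainder, (i1)
cumulant remainder are print's verbatim (`errPB_remainder_le`, `errPB_eps_le` apply by name).  This file supplies the three atoms that change and the
volume atom at `|□′|`, each at a cut-off `γ′b ≤ c ≤ Γb`, with the class letters entering through ROWS a ledger can discharge from the class constants:
`K_u ≤ C_Ku·b`, `K₀ ≤ C_K0·b` (seat n08-d's `…KernelSect5ClassStep` instantiates `K_u := (1 + VM/(γ_A−J_c))·(γb)`, `K₀ := max(max 1 (1/(γ_A−J_c)), K_u)`,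
so BOTH grow linearly with the cut-off and `K₀` enters the moment constant `momentConst D (2(k+1)) K₀ = …·e^{K₀/2}` — a linear exponential, paid here by
half of (5.29)'s Gaussian root), `ε₃₁ ≤ C_ε·b^{q}·e^{−θ₁X}` with the two-regime width row `b₀ ≤ b → M·b^{3/2} ≤ X`, `|□′| ≤ L^d`.

WHAT IS PROVED (theorems only; no definition, no named fact, no `sorry`; axioms standard).
* §0 normal forms of the class letters: `momentConst_le_exp_mul` (`momentConst q n c₀ ≤ 2(q+1)(nq)!·e^{(C_m/2)b}` from `c₀ ≤ C_m·b`),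
  `max_max_one_le_mul` (`max(max 1 C₀₀, C_u(γc)) ≤ (max 1 C₀₀ + C_uΓ)·b`, any `C_u ≥ 0` — seat n08-d's `K₀`), `mul_cutoff_le_mul` (`C_u(γc) ≤ (C_uΓ)b` — its `K_u`).
* ★ `errPB_volume_class_le` — (h) at the true volume: `e^{2K}·3·V·e^{−c²/4} ≤ (3·2^d·(2d)!·e^{27ρ⁴/4})·snd` for `V ≤ L^d`.
* ★★ `errPB_chi_class_le` — (i2) with `(1 + K_u)^D`, a cut-off-dependent moment size `c₀ ≤ C_m·b` and `min 1 (2·V·e^{−c²/4})`: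
  `≤ (C·e^{a²/(2g)}·q!·(k+1)!·e^{27ρ⁴/4})·snd`, the linear exponential of the moment constants paid by half of the Gaussian root.
* ★★ `errPB_d29_class_le` — (i3) with the row `K₀ ≤ C_K0·b`: `≤ (C·(k+1)!·(q! + b₀^q e^{ρ₃b₀^{3/2}}))·snd` in both regimes.
* ★★ `errPB_d31_class_le` — (i4) with the rows `K₀ ≤ C_K0·b`, `ε₃₁ ≤ C_ε·b^{q_ε}·e^{−θ₁X}`: `≤ (C·(k+1)!·(q! + b₀^q e^{ρ₃b₀^{3/2}}))·snd` in both regimes.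
(`snd = e^{−ρ₃b^{3/2}}·e^{ρ₄Ab^{ρ₃}}`, the second summand of `errTerm`; every `C` closed and displayed; atoms (g) remainder and (i1) cumulant remainder of
the class step are print's VERBATIM — `…LedgerDischarge.errPB_remainder_le` / `errPB_eps_le` apply by name.)

HONEST SCOPE / NOT HERE.  Elementary real analysis; no measure theory; which rows the class assembler's `K_u`, `K₀`, `ε₃₁` satisfy is seat n08-c's
`…KernelSect5ClassLowerStep` / seat n08-w5's `…KernelSect5PartFieldRows`, not here; the class ledger packs and the ∃-knit are NOT here; no generalised Basic
Lemma is stated; count-neutral for N08; nothing of [Balaban1985UV3] (41)/(47)/(5) is asserted; nothing about d = 4, the continuum, OS axioms, a mass gap or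
the Clay problem.
-/

noncomputable section

open Finset
open scoped BigOperators Nat

namespace Literature.MathematicalPhysics.QuantumFieldTheory.Balaban1983to89.B1Eq324BenfattoKernelSect5LedgerPerBox

open Literature.MathematicalPhysics.QuantumFieldTheory.Balaban1983to89.B1Eq324BenfattoLemma
open Literature.MathematicalPhysics.QuantumFieldTheory.Balaban1983to89.B1Eq324BenfattoSect5ErrTermLedger
open Literature.MathematicalPhysics.QuantumFieldTheory.Balaban1983to89.B1Eq324BenfattoSect5Eq511 (s1Const)
open Literature.MathematicalPhysics.QuantumFieldTheory.Balaban1983to89.B1Eq324GaussianMomentLeaf (momentConst)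
open Literature.Probability.LatticeModels (setPartitions)
open Literature.MathematicalPhysics.QuantumFieldTheory.Balaban1983to89.B1Eq324BenfattoSect5LedgerDischarge

variable {s D d t : ℕ} {κ A b c Γ γ' δ ρ₁ ρ₂ ρ₃ ρ₄ b₀ M : ℝ} {L w v : ℕ}

/-- kernel: `0 ≤ momentConst q n c₀` (it is `2(q+1)·(nq)!·e^{c₀/2}`). [folklore] -/
private theorem momentConst_nonneg' (q n : ℕ) (c₀ : NNReal) : 0 ≤ momentConst q n c₀ := by
  unfold momentConst
  positivity

/-! ## §0  Normal forms of the class letters -/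

/-- **The moment constant at a cut-off-dependent size**: `momentConst q n c₀ = 2(q+1)·(nq)!·e^{c₀/2} ≤ (2(q+1)·(nq)!)·e^{(C_m/2)·b}` whenever
`c₀ ≤ C_m·b` (seat n08-d's class step feeds `c₀ = K₀ = max(max 1 (1/(γ_A−J_c)), K_u)` with `K_u ∝ γb` into the moment constant; a cut-off-free `c₀`
takes `C_m := c₀` for `b ≥ 1`). [cite: Balaban1982Higgs1, (3.24) p.616; BenfattoEtAl1978, (5.29) p.157] -/
theorem momentConst_le_exp_mul {q n : ℕ} {c₀ : NNReal} {Cm b : ℝ} (hc₀ : (c₀ : ℝ) ≤ Cm * b) :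
    momentConst q n c₀ ≤ (2 * (q + 1) * ((n * q) ! : ℝ)) * Real.exp (Cm / 2 * b) := by
  unfold momentConst
  refine mul_le_mul_of_nonneg_left (Real.exp_le_exp.mpr (by linarith)) (by positivity)

/-- **A linear exponential costs half a Gaussian**: `e^{a·b}·e^{−g·b²} ≤ e^{a²/(2g)}·e^{−(g/2)·b²}` for `g > 0` (complete the square:
`(g/2)(b − a/g)² ≥ 0`). [folklore] -/
private theorem exp_lin_mul_gauss_le (a b : ℝ) {g : ℝ} (hg : 0 < g) :
    Real.exp (a * b) * Real.exp (-(g * b ^ 2)) ≤ Real.exp (a ^ 2 / (2 * g)) * Real.exp (-(g / 2 * b ^ 2)) := by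
  rw [← Real.exp_add, ← Real.exp_add, Real.exp_le_exp]
  have hsq : 0 ≤ g / 2 * (b - a / g) ^ 2 := by positivity
  have hexp : g / 2 * (b - a / g) ^ 2 = g / 2 * b ^ 2 - a * b + a ^ 2 / (2 * g) := by
    field_simp
    ring
  linarith

/-- **The class propagator letter in normal form** (generalises `…LedgerDischarge.K0_le`, whose coefficient is print's `1 + 2d/α²`): for any
coefficient `C_u ≥ 0`, `max(max 1 C₀₀, C_u·(γc)) ≤ (max 1 C₀₀ + C_u·Γ)·b` at a cut-off `0 ≤ c ≤ Γb`, `γ ≤ 1`, `b ≥ 1` — the row `K₀ ≤ C_K0·b` of §3–§4 for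
seat n08-d's `K₀ := max (max 1 (1/(γ_A − J_c))) ((1 + VM/(γ_A − J_c))·(γb))`. [cite: BenfattoEtAl1978, Appendix D p.165, (C.8) p.165 (class form; ours)] -/
theorem max_max_one_le_mul {C00 Cu γ : ℝ} (hb : 1 ≤ b) (hCu : 0 ≤ Cu) (hγ1 : γ ≤ 1) (hc : 0 ≤ c) (hcb : c ≤ Γ * b) :
    max (max 1 C00) (Cu * (γ * c)) ≤ (max 1 C00 + Cu * Γ) * b := by
  have hγc : γ * c ≤ Γ * b := (mul_le_of_le_one_left hc hγ1).trans hcb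
  have hm : 0 ≤ max 1 C00 := le_max_of_le_left zero_le_one
  have hCΓb : 0 ≤ Cu * (Γ * b) := mul_nonneg hCu (hc.trans hcb)
  have hsplit : (max 1 C00 + Cu * Γ) * b = max 1 C00 * b + Cu * (Γ * b) := by ring
  refine max_le ?_ ?_
  · calc max 1 C00 = max 1 C00 * 1 := (mul_one _).symm
      _ ≤ max 1 C00 * b := mul_le_mul_of_nonneg_left hb hm
      _ ≤ (max 1 C00 + Cu * Γ) * b := by rw [hsplit]; linarith
  · calc Cu * (γ * c) ≤ Cu * (Γ * b) := mul_le_mul_of_nonneg_left hγc hCu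
      _ ≤ (max 1 C00 + Cu * Γ) * b := by
          rw [hsplit]
          linarith [mul_nonneg hm (zero_le_one.trans hb)]

/-- **A cut-off-proportional letter in normal form**: `X ≤ C·(γc) ≤ (C·Γ)·b` for `C ≥ 0`, `γ ≤ 1`, `0 ≤ c ≤ Γb` — the row `K_u ≤ C_Ku·b` of §2 for seat
n08-d's `K_u := (1 + VM/(γ_A − J_c))·(γb)`. [cite: BenfattoEtAl1978, (C.8) p.165 (class form; ours)] -/
theorem mul_cutoff_le_mul {Cu γ : ℝ} (hCu : 0 ≤ Cu) (hγ1 : γ ≤ 1) (hc : 0 ≤ c) (hcb : c ≤ Γ * b) :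
    Cu * (γ * c) ≤ (Cu * Γ) * b := by
  have hγc : γ * c ≤ Γ * b := (mul_le_of_le_one_left hc hγ1).trans hcb
  calc Cu * (γ * c) ≤ Cu * (Γ * b) := mul_le_mul_of_nonneg_left hγc hCu
    _ = (Cu * Γ) * b := by ring

/-! ## §1  Atom (h) at the true volume `|□′|` -/

/-- **ATOM (h) AT THE TRUE VOLUME — the small-field volume loss `e^{2K}·3|□′|e^{−c²/4}` of (5.19)/(5.20) for the class step**: for any volume letter
`0 ≤ V ≤ L^d` (the class step displays `V = |shrink L m w|`, print's normal form `L^d`; `…Sect5Eq524.card_shrink_le`), at a cut-off `γ′b ≤ c ≤ Γb`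
(`γ′ > 0`), `L ≤ 2b²`, `b ≥ 1`, `c₂ := 8s₁(D)Γ^D2^d ≤ ρ₄`, `D + 2d ≤ ρ₃`:
`e^{2K}·3·V·e^{−c²/4} ≤ (3·2^d·(2d)!·e^{27ρ⁴/4})·e^{−ρ₃b^{3/2}}e^{ρ₄Ab^{ρ₃}}`, `ρ = (ρ₃+1)/γ′^{3/2}` (`…LedgerDischarge.errPB_volume_le` after `V ≤ L^d`;
any sign of `V`).
[cite: BenfattoEtAl1978, (5.19)–(5.20) p.156, (4.7) p.152; Balaban1985BackgroundPropagators, Sect. E p.428 (class form; ours)] -/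
theorem errPB_volume_class_le {V : ℝ} (hκ : 0 ≤ κ) (hA : 0 ≤ A) (hb : 1 ≤ b) (hΓ : 0 ≤ Γ) (hc : 0 ≤ c) (hcb : c ≤ Γ * b)
    (hL : ((L : ℕ) : ℝ) ≤ 2 * b ^ 2) (hV : V ≤ ((L : ℕ) : ℝ) ^ d)
    (hγ' : 0 < γ') (hγc : γ' * b ≤ c) (hρ₃ : (D : ℝ) + 2 * d ≤ ρ₃) (hρ₄ : 8 * s1Const D D d κ * Γ ^ D * 2 ^ d ≤ ρ₄) :
    Real.exp (2 * (4 * (s1Const s D d κ * A * c ^ D * ((L : ℕ) : ℝ) ^ d))) * (3 * (V * Real.exp (-(c ^ 2 / 4)))) ≤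
      (3 * 2 ^ d * (2 * d).factorial * Real.exp (27 / 4 * ((ρ₃ + 1) / γ' ^ (3 / 2 : ℝ)) ^ 4)) *
        (Real.exp (-(ρ₃ * b ^ (3 / 2 : ℝ))) * Real.exp (ρ₄ * A * b ^ ρ₃)) := by
  have hstep : Real.exp (2 * (4 * (s1Const s D d κ * A * c ^ D * ((L : ℕ) : ℝ) ^ d))) * (3 * (V * Real.exp (-(c ^ 2 / 4)))) ≤
      Real.exp (2 * (4 * (s1Const s D d κ * A * c ^ D * ((L : ℕ) : ℝ) ^ d))) * (3 * (((L : ℕ) : ℝ) ^ d * Real.exp (-(c ^ 2 / 4)))) := by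
    gcongr
  exact hstep.trans (errPB_volume_le (s := s) hκ hA hb hΓ hc hcb hL hγ' hγc hρ₃ hρ₄)

/-! ## §2  Atom (i2) with the class centre letter `K_u` and the true volume -/

/-- kernel: `(1 + K_u)^D ≤ (1 + C_Ku)^D·b^D` from `0 ≤ K_u ≤ C_Ku·b`, `b ≥ 1`. [folklore] -/
private theorem one_add_Ku_pow_le {Ku CKu : ℝ} (hb : 1 ≤ b) (hKu0 : 0 ≤ Ku) (hKu : Ku ≤ CKu * b) (D : ℕ) :
    (1 + Ku) ^ D ≤ (1 + CKu) ^ D * b ^ D := by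
  rw [← mul_pow]
  refine pow_le_pow_left₀ (by positivity) ?_ D
  nlinarith

set_option maxHeartbeats 400000 in
/-- **ATOM (i2) FOR THE CLASS — the `χ → 1` constant `cχ(k+1)` of (5.29) with the centre letter `K_u`, a cut-off-dependent moment size and the true
volume** (class step `…KernelSect5StepBound.exists_lower_step`, conj 3:
`3^{k+1}·2^{k+1}(Σ_π(|π|−1)!)·(min 1 (2|□′|e^{−c²/4}))^{1/(2(k+1))}·((1+K_u)^D·(A·L^d·Σ₁(s))·m)^{k+1}`, `m = momentConst D (2(k+1)) c₀ = 2(D+1)((2(k+1))D)!e^{c₀/2}`,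
less the leading `3^{k+1}` which the assembler keeps outside): at a cut-off `c ≥ γ′b` (`γ′ > 0`), with rows `0 ≤ K_u ≤ C_Ku·b`, `c₀ ≤ C_m·b`
(`C_Ku, C_m ≥ 0`; seat n08-d's `K_u = (1 + VM/(γ_A−J_c))·(γc)`, `c₀ = K₀ = max(max 1 (1/(γ_A−J_c)), K_u)` — `mul_cutoff_le_mul`, `max_max_one_le_mul`),
`0 ≤ V ≤ L^d`, `L ≤ 2b²`, `b ≥ 1`, and `r := 1/(2(k+1))`, `g := r·γ′²/4`, `a := (k+1)·C_m/2`, `q := 2d + (D+2d)(k+1)`,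
`C := 2^{k+1}(Σ_π)·2·2^d·((1+C_Ku)^D·2^dΣ₁(D)·2(D+1)((2(k+1))D)!)^{k+1}·e^{a²/(2g)}`:
`cχ ≤ (C·q!·(k+1)!·e^{27ρ⁴/4})·e^{−ρ₃b^{3/2}}e^{ρ₄Ab^{ρ₃}}`, `ρ = (ρ₃+1)/(√(r/2)·γ′)^{3/2}` (`ρ₃ ≥ 0`, `ρ₄ ≥ 1`): the proof of
`…LedgerDischarge.errPB_chi_le` with the `K_u` row for `one_add_cutoff_pow_le`, and the linear exponential `e^{(k+1)c₀/2} ≤ e^{a·b}` of the moment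
constants paid by HALF of the Gaussian root `e^{−r(γ′b)²/4}` (`e^{ab}e^{−gb²} ≤ e^{a²/(2g)}e^{−(g/2)b²}`).
[cite: BenfattoEtAl1978, (5.29) p.157, (C.9) p.165, (4.7) p.152; Balaban1985BackgroundPropagators, Sect. E p.428 (class form; ours)] -/
theorem errPB_chi_class_le {c₀ : NNReal} {Ku CKu Cm V : ℝ} (hκ : 0 ≤ κ) (hA : 0 ≤ A) (hb : 1 ≤ b)
    (hL : ((L : ℕ) : ℝ) ≤ 2 * b ^ 2) (hKu0 : 0 ≤ Ku) (hKu : Ku ≤ CKu * b) (hCKu : 0 ≤ CKu) (hc₀ : (c₀ : ℝ) ≤ Cm * b)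
    (hV0 : 0 ≤ V) (hV : V ≤ ((L : ℕ) : ℝ) ^ d)
    (hγ' : 0 < γ') (hγc : γ' * b ≤ c) (hρ₃ : 0 ≤ ρ₃) (hρ₄ : 1 ≤ ρ₄) (k : ℕ) :
    2 ^ (k + 1) * ((∑ π ∈ setPartitions (univ : Finset (Fin (k + 1))), ((π.card - 1)! : ℝ)) *
        ((min 1 (2 * V * Real.exp (-(c ^ 2 / 4)))) ^ ((2 * (k + 1) : ℕ) : ℝ)⁻¹ *
          ((1 + Ku) ^ D *
              (A * ((L : ℕ) : ℝ) ^ d * ∑ p ∈ Finset.Icc 1 s, ((admissible p D).card : ℝ) *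
                ((2 / (1 - Real.exp (-(κ / 2 / (p : ℕ) / Real.sqrt d))) * Real.exp (κ / 2 / (p : ℕ) / Real.sqrt d)) ^ d) ^ (p - 1)) *
            momentConst D (2 * (k + 1)) c₀) ^ (k + 1))) ≤
      ((2 ^ (k + 1) * (∑ π ∈ setPartitions (univ : Finset (Fin (k + 1))), ((π.card - 1)! : ℝ)) * (2 * 2 ^ d) *
          ((1 + CKu) ^ D * (2 ^ d * ∑ p ∈ Finset.Icc 1 D, ((admissible p D).card : ℝ) *
                ((2 / (1 - Real.exp (-(κ / 2 / (p : ℕ) / Real.sqrt d))) * Real.exp (κ / 2 / (p : ℕ) / Real.sqrt d)) ^ d) ^ (p - 1)) *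
            (2 * (D + 1) * (((2 * (k + 1)) * D) ! : ℝ))) ^ (k + 1)) *
          Real.exp (((k + 1) * (Cm / 2)) ^ 2 / (2 * ((((2 * (k + 1) : ℕ) : ℝ))⁻¹ * γ' ^ 2 / 4))) *
          (2 * d + (D + 2 * d) * (k + 1)).factorial * (k + 1).factorial *
          Real.exp (27 / 4 * ((ρ₃ + 1) / (Real.sqrt ((((2 * (k + 1) : ℕ) : ℝ))⁻¹ / 2) * γ') ^ (3 / 2 : ℝ)) ^ 4)) *
        (Real.exp (-(ρ₃ * b ^ (3 / 2 : ℝ))) * Real.exp (ρ₄ * A * b ^ ρ₃)) := by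
  have hb0 : 0 ≤ b := zero_le_one.trans hb
  have hγb : 0 ≤ γ' * b := mul_nonneg hγ'.le hb0
  have h1K : (0 : ℝ) ≤ 1 + CKu := by positivity
  obtain ⟨hSig0, hSigle⟩ := sum_adm_geom_nonneg_le (X := κ / 2) (by linarith) s D d
  obtain ⟨hSigD0, -⟩ := sum_adm_geom_nonneg_le (X := κ / 2) (by linarith) D D d
  set Sigs := ∑ p ∈ Finset.Icc 1 s, ((admissible p D).card : ℝ) *
      ((2 / (1 - Real.exp (-(κ / 2 / (p : ℕ) / Real.sqrt d))) * Real.exp (κ / 2 / (p : ℕ) / Real.sqrt d)) ^ d) ^ (p - 1) with hSigs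
  set SigD := ∑ p ∈ Finset.Icc 1 D, ((admissible p D).card : ℝ) *
      ((2 / (1 - Real.exp (-(κ / 2 / (p : ℕ) / Real.sqrt d))) * Real.exp (κ / 2 / (p : ℕ) / Real.sqrt d)) ^ d) ^ (p - 1) with hSigD
  clear_value Sigs SigD
  set P := ∑ π ∈ setPartitions (univ : Finset (Fin (k + 1))), ((π.card - 1)! : ℝ) with hP
  have hP0 : 0 ≤ P := Finset.sum_nonneg fun π _ => Nat.cast_nonneg _
  clear_value P
  -- the moment constant at the cut-off: `m ≤ mK·e^{(C_m/2)·b}`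
  set mK : ℝ := 2 * (D + 1) * (((2 * (k + 1)) * D) ! : ℝ) with hmK
  have hmK0 : 0 ≤ mK := by rw [hmK]; positivity
  have hmc0 := momentConst_nonneg' D (2 * (k + 1)) c₀
  have hmle : momentConst D (2 * (k + 1)) c₀ ≤ mK * Real.exp (Cm / 2 * b) := by
    rw [hmK]
    have h := momentConst_le_exp_mul (q := D) (n := 2 * (k + 1)) hc₀
    simpa [Nat.cast_ofNat] using h
  clear_value mK
  set r : ℝ := (((2 * (k + 1) : ℕ) : ℝ))⁻¹ with hr
  have hr0 : 0 < r := by rw [hr]; positivity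
  have hr1 : r ≤ 1 := inv_le_one_of_one_le₀ (by rw [Nat.cast_mul]; push_cast; linarith)
  clear_value r
  -- the root of the Gaussian, at the true volume `V ≤ L^d ≤ 2^d b^{2d}`
  have hLd := side_pow_le hL d
  have hVb : V ≤ 2 ^ d * b ^ (2 * d) := hV.trans hLd
  have hmin : (min 1 (2 * V * Real.exp (-(c ^ 2 / 4)))) ^ r ≤
      2 * (2 ^ d * b ^ (2 * d)) * Real.exp (-((Real.sqrt r * γ' * b) ^ 2 / 4)) := by
    have hmono : min 1 (2 * V * Real.exp (-(c ^ 2 / 4))) ≤ min 1 ((2 * (2 ^ d * b ^ (2 * d))) * Real.exp (-(c ^ 2 / 4))) :=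
      min_le_min le_rfl (mul_le_mul_of_nonneg_right (by linarith) (Real.exp_pos _).le)
    have hmin0 : 0 ≤ min 1 (2 * V * Real.exp (-(c ^ 2 / 4))) := le_min zero_le_one (by positivity)
    have hone : (1 : ℝ) ≤ 2 * (2 ^ d * b ^ (2 * d)) := by
      have : (1 : ℝ) ≤ 2 ^ d * b ^ (2 * d) := one_le_mul_of_one_le_of_one_le (one_le_pow₀ (by norm_num)) (one_le_pow₀ hb)
      linarith
    have h1 := min_one_mul_rpow_le (P := 2 * (2 ^ d * b ^ (2 * d))) (x := Real.exp (-(c ^ 2 / 4))) (Real.exp_pos _).le hone hr0.le hr1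
    have h2 := exp_neg_rpow_cutoff_le hr0.le hγb hγc
    calc (min 1 (2 * V * Real.exp (-(c ^ 2 / 4)))) ^ r
        ≤ (min 1 ((2 * (2 ^ d * b ^ (2 * d))) * Real.exp (-(c ^ 2 / 4)))) ^ r := Real.rpow_le_rpow hmin0 hmono hr0.le
      _ ≤ 2 * (2 ^ d * b ^ (2 * d)) * Real.exp (-(c ^ 2 / 4)) ^ r := h1
      _ ≤ 2 * (2 ^ d * b ^ (2 * d)) * Real.exp (-((Real.sqrt r * γ' * b) ^ 2 / 4)) := by gcongr
  -- the `(1 + K_u)^D` factor, the mass, the moment constant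
  have hf := one_add_Ku_pow_le hb hKu0 hKu D
  have hf0 : 0 ≤ (1 + Ku) ^ D := by positivity
  have hM : A * ((L : ℕ) : ℝ) ^ d * Sigs ≤ A * (2 ^ d * b ^ (2 * d)) * SigD := by gcongr
  have hM0 : 0 ≤ A * ((L : ℕ) : ℝ) ^ d * Sigs := by positivity
  have hprod : ((1 + Ku) ^ D * (A * ((L : ℕ) : ℝ) ^ d * Sigs) * momentConst D (2 * (k + 1)) c₀) ^ (k + 1) ≤
      (((1 + CKu) ^ D * b ^ D) * (A * (2 ^ d * b ^ (2 * d)) * SigD) * (mK * Real.exp (Cm / 2 * b))) ^ (k + 1) := by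
    gcongr
  have hexppow : Real.exp (Cm / 2 * b) ^ (k + 1) = Real.exp ((k + 1) * (Cm / 2) * b) := by
    rw [← Real.exp_nat_mul]
    congr 1
    push_cast
    ring
  have hsplit : (((1 + CKu) ^ D * b ^ D) * (A * (2 ^ d * b ^ (2 * d)) * SigD) * (mK * Real.exp (Cm / 2 * b))) ^ (k + 1) =
      ((1 + CKu) ^ D * (2 ^ d * SigD) * mK) ^ (k + 1) * b ^ ((D + 2 * d) * (k + 1)) * A ^ (k + 1) *
        Real.exp ((k + 1) * (Cm / 2) * b) := by
    have : ((1 + CKu) ^ D * b ^ D) * (A * (2 ^ d * b ^ (2 * d)) * SigD) * (mK * Real.exp (Cm / 2 * b)) =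
        ((1 + CKu) ^ D * (2 ^ d * SigD) * mK) * (b ^ (D + 2 * d) * A) * Real.exp (Cm / 2 * b) := by ring
    rw [this, mul_pow, mul_pow, hexppow]
    ring
  -- the linear exponential against half the Gaussian root
  set g : ℝ := r * γ' ^ 2 / 4 with hg
  have hg0 : 0 < g := by rw [hg]; positivity
  have hgauss : Real.exp (-((Real.sqrt r * γ' * b) ^ 2 / 4)) = Real.exp (-(g * b ^ 2)) := by
    rw [hg]; congr 1
    have : (Real.sqrt r) ^ 2 = r := Real.sq_sqrt hr0.le
    rw [show (Real.sqrt r * γ' * b) ^ 2 = (Real.sqrt r) ^ 2 * γ' ^ 2 * b ^ 2 by ring, this]; ring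
  have hhalf : Real.exp (-(g / 2 * b ^ 2)) = Real.exp (-((Real.sqrt (r / 2) * γ' * b) ^ 2 / 4)) := by
    rw [hg]; congr 1
    have : (Real.sqrt (r / 2)) ^ 2 = r / 2 := Real.sq_sqrt (by positivity)
    rw [show (Real.sqrt (r / 2) * γ' * b) ^ 2 = (Real.sqrt (r / 2)) ^ 2 * γ' ^ 2 * b ^ 2 by ring, this]; ring
  have hlin := exp_lin_mul_gauss_le ((k + 1) * (Cm / 2)) b hg0
  -- the closed constant and the Gaussian atom at `√(r/2)·γ′`
  set C₁ : ℝ := 2 ^ (k + 1) * P * (2 * 2 ^ d) * ((1 + CKu) ^ D * (2 ^ d * SigD) * mK) ^ (k + 1) with hC₁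
  have hC₁0 : 0 ≤ C₁ := by rw [hC₁]; positivity
  have hC0 : 0 ≤ C₁ * Real.exp (((k + 1) * (Cm / 2)) ^ 2 / (2 * g)) := by positivity
  have hatom := gauss_atom_le_snd' (A := A) (b := b) (ρ₃ := ρ₃) (ρ₄ := ρ₄)
    (C := C₁ * Real.exp (((k + 1) * (Cm / 2)) ^ 2 / (2 * g)))
    (γ' := Real.sqrt (r / 2) * γ') hC0 hA hb hρ₃ (mul_pos (Real.sqrt_pos.mpr (by positivity)) hγ') hρ₄ (2 * d + (D + 2 * d) * (k + 1)) (k + 1)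
  have hstep1 : 2 ^ (k + 1) * (P * ((min 1 (2 * V * Real.exp (-(c ^ 2 / 4)))) ^ r *
          ((1 + Ku) ^ D * (A * ((L : ℕ) : ℝ) ^ d * Sigs) * momentConst D (2 * (k + 1)) c₀) ^ (k + 1)))
      ≤ 2 ^ (k + 1) * (P * ((2 * (2 ^ d * b ^ (2 * d)) * Real.exp (-((Real.sqrt r * γ' * b) ^ 2 / 4))) *
          ((((1 + CKu) ^ D * b ^ D) * (A * (2 ^ d * b ^ (2 * d)) * SigD) * (mK * Real.exp (Cm / 2 * b))) ^ (k + 1)))) :=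
    mul_le_mul_of_nonneg_left (mul_le_mul_of_nonneg_left (mul_le_mul hmin hprod
      (pow_nonneg (mul_nonneg (mul_nonneg hf0 hM0) hmc0) _)
      (mul_nonneg (mul_nonneg zero_le_two (mul_nonneg (pow_nonneg zero_le_two _) (pow_nonneg hb0 _))) (Real.exp_pos _).le)) hP0)
      (pow_nonneg zero_le_two _)
  have hstep2 : 2 ^ (k + 1) * (P * ((2 * (2 ^ d * b ^ (2 * d)) * Real.exp (-((Real.sqrt r * γ' * b) ^ 2 / 4))) *
          ((((1 + CKu) ^ D * b ^ D) * (A * (2 ^ d * b ^ (2 * d)) * SigD) * (mK * Real.exp (Cm / 2 * b))) ^ (k + 1))))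
      = C₁ * b ^ (2 * d + (D + 2 * d) * (k + 1)) * A ^ (k + 1) *
          (Real.exp ((k + 1) * (Cm / 2) * b) * Real.exp (-(g * b ^ 2))) := by
    rw [hsplit, hgauss, hC₁]; ring
  have hstep3 : C₁ * b ^ (2 * d + (D + 2 * d) * (k + 1)) * A ^ (k + 1) *
          (Real.exp ((k + 1) * (Cm / 2) * b) * Real.exp (-(g * b ^ 2)))
      ≤ C₁ * b ^ (2 * d + (D + 2 * d) * (k + 1)) * A ^ (k + 1) *
          (Real.exp (((k + 1) * (Cm / 2)) ^ 2 / (2 * g)) * Real.exp (-(g / 2 * b ^ 2))) :=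
    mul_le_mul_of_nonneg_left hlin (by positivity)
  have hstep4 : C₁ * b ^ (2 * d + (D + 2 * d) * (k + 1)) * A ^ (k + 1) *
          (Real.exp (((k + 1) * (Cm / 2)) ^ 2 / (2 * g)) * Real.exp (-(g / 2 * b ^ 2)))
      = (C₁ * Real.exp (((k + 1) * (Cm / 2)) ^ 2 / (2 * g))) * b ^ (2 * d + (D + 2 * d) * (k + 1)) * A ^ (k + 1) *
          Real.exp (-((Real.sqrt (r / 2) * γ' * b) ^ 2 / 4)) := by
    rw [hhalf]; ring
  have hfin := (hstep1.trans_eq hstep2).trans (hstep3.trans_eq hstep4)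
  refine hfin.trans ?_
  simpa only [hC₁, hg] using hatom

/-! ## §3  Atom (i3) with the class propagator letter `K₀` -/

/-- **ATOM (i3) FOR THE CLASS — the Appendix-D constant `δ₂₉(k+1)` of (5.29) with the letter `K₀`** (class step conj 3:
`2^{(k+1)D}2^{2^{(k+1)D}}K₀^{(k+1)D}·e^{−(δ/2)(v+1)}·(A·e^{(δ/2)D²d}·L^d·Σ₂(s))^{k+1}`): with the row `0 ≤ K₀ ≤ C_K0·b` (a cut-off-free `K₀` takes `C_K0 := K₀`;
seat n08-d's `K₀ = max(max 1 (1/(γ_A−J_c)), K_u)` takes `max_max_one_le_mul`), `ϰ′ = ϰ/2 − (δ/2)D²√d ≥ 0`, `q := (k+1)D + 2d(k+1)`,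
`C := 2^{(k+1)D}2^{2^{(k+1)D}}C_K0^{(k+1)D}(e^{(δ/2)D²d}2^dΣ₂(D))^{k+1}`: `δ₂₉(k+1) ≤ (C·(k+1)!·(q! + b₀^q e^{ρ₃b₀^{3/2}}))·e^{−ρ₃b^{3/2}}e^{ρ₄Ab^{ρ₃}}` in BOTH
regimes, given `b₀ ≤ b → M·b^{3/2} ≤ v`, `ρ₃ + 1 ≤ (δ/2)·M`, `δ ≥ 0`, `L ≤ 2b²`, `b ≥ 1` (`…LedgerDischarge.decay_atom_le_snd` at width `v + 1`; the proof of
`…LedgerDischarge.errPB_d29_le` with `K0_le` replaced by the row).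
[cite: BenfattoEtAl1978, (5.29) p.157, Appendix D p.165, (4.7) p.152; Balaban1985BackgroundPropagators, Sect. E p.428 (class form; ours)] -/
theorem errPB_d29_class_le {K₀ CK0 : ℝ} (hA : 0 ≤ A) (hb : 1 ≤ b) (hL : ((L : ℕ) : ℝ) ≤ 2 * b ^ 2) (hK₀ : 0 ≤ K₀) (hK₀b : K₀ ≤ CK0 * b)
    (hδ : 0 ≤ δ) (hκ' : 0 ≤ κ / 2 - δ / 2 * ((D : ℝ) ^ 2 * Real.sqrt d))
    (hb₀ : 0 ≤ b₀) (hρ₃ : 0 ≤ ρ₃) (hρ₄ : 1 ≤ ρ₄) (hreg : b₀ ≤ b → M * b ^ (3 / 2 : ℝ) ≤ (v : ℝ)) (hM : ρ₃ + 1 ≤ δ / 2 * M) (k : ℕ) :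
    2 ^ ((k + 1) * D) * 2 ^ 2 ^ ((k + 1) * D) * K₀ ^ ((k + 1) * D) * Real.exp (-(δ / 2 * ((v : ℝ) + 1))) *
        (A * Real.exp (δ / 2 * ((D : ℝ) ^ 2 * d)) * ((L : ℕ) : ℝ) ^ d * ∑ p ∈ Finset.Icc 1 s, ((admissible p D).card : ℝ) *
            ((2 / (1 - Real.exp (-((κ / 2 - δ / 2 * ((D : ℝ) ^ 2 * Real.sqrt d)) / (p : ℕ) / Real.sqrt d))) *
              Real.exp ((κ / 2 - δ / 2 * ((D : ℝ) ^ 2 * Real.sqrt d)) / (p : ℕ) / Real.sqrt d)) ^ d) ^ (p - 1)) ^ (k + 1) ≤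
      ((2 ^ ((k + 1) * D) * 2 ^ 2 ^ ((k + 1) * D) * CK0 ^ ((k + 1) * D) *
          (Real.exp (δ / 2 * ((D : ℝ) ^ 2 * d)) * 2 ^ d * ∑ p ∈ Finset.Icc 1 D, ((admissible p D).card : ℝ) *
            ((2 / (1 - Real.exp (-((κ / 2 - δ / 2 * ((D : ℝ) ^ 2 * Real.sqrt d)) / (p : ℕ) / Real.sqrt d))) *
              Real.exp ((κ / 2 - δ / 2 * ((D : ℝ) ^ 2 * Real.sqrt d)) / (p : ℕ) / Real.sqrt d)) ^ d) ^ (p - 1)) ^ (k + 1)) *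
          (k + 1).factorial * (((k + 1) * D + 2 * d * (k + 1)).factorial +
            b₀ ^ ((k + 1) * D + 2 * d * (k + 1)) * Real.exp (ρ₃ * b₀ ^ (3 / 2 : ℝ)))) *
        (Real.exp (-(ρ₃ * b ^ (3 / 2 : ℝ))) * Real.exp (ρ₄ * A * b ^ ρ₃)) := by
  have hb0 : 0 ≤ b := zero_le_one.trans hb
  have hCK0 : 0 ≤ CK0 := by
    by_contra h
    have h' : CK0 < 0 := lt_of_not_ge h
    have : CK0 * b < 0 := mul_neg_of_neg_of_pos h' (by linarith)
    linarith
  obtain ⟨hSig0, hSigle⟩ := sum_adm_geom_nonneg_le hκ' s D d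
  obtain ⟨hSigD0, -⟩ := sum_adm_geom_nonneg_le hκ' D D d
  set Sigs := ∑ p ∈ Finset.Icc 1 s, ((admissible p D).card : ℝ) *
      ((2 / (1 - Real.exp (-((κ / 2 - δ / 2 * ((D : ℝ) ^ 2 * Real.sqrt d)) / (p : ℕ) / Real.sqrt d))) *
        Real.exp ((κ / 2 - δ / 2 * ((D : ℝ) ^ 2 * Real.sqrt d)) / (p : ℕ) / Real.sqrt d)) ^ d) ^ (p - 1) with hSigs
  set SigD := ∑ p ∈ Finset.Icc 1 D, ((admissible p D).card : ℝ) *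
      ((2 / (1 - Real.exp (-((κ / 2 - δ / 2 * ((D : ℝ) ^ 2 * Real.sqrt d)) / (p : ℕ) / Real.sqrt d))) *
        Real.exp ((κ / 2 - δ / 2 * ((D : ℝ) ^ 2 * Real.sqrt d)) / (p : ℕ) / Real.sqrt d)) ^ d) ^ (p - 1) with hSigD
  clear_value Sigs SigD
  have hK₀pow : K₀ ^ ((k + 1) * D) ≤ CK0 ^ ((k + 1) * D) * b ^ ((k + 1) * D) := by
    rw [← mul_pow]; exact pow_le_pow_left₀ hK₀ hK₀b _
  have hLd := side_pow_le hL d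
  have hMt : A * Real.exp (δ / 2 * ((D : ℝ) ^ 2 * d)) * ((L : ℕ) : ℝ) ^ d * Sigs ≤
      A * Real.exp (δ / 2 * ((D : ℝ) ^ 2 * d)) * (2 ^ d * b ^ (2 * d)) * SigD := by gcongr
  have hMt0 : 0 ≤ A * Real.exp (δ / 2 * ((D : ℝ) ^ 2 * d)) * ((L : ℕ) : ℝ) ^ d * Sigs := by positivity
  have hMtpow : (A * Real.exp (δ / 2 * ((D : ℝ) ^ 2 * d)) * ((L : ℕ) : ℝ) ^ d * Sigs) ^ (k + 1) ≤
      (Real.exp (δ / 2 * ((D : ℝ) ^ 2 * d)) * 2 ^ d * SigD) ^ (k + 1) * b ^ (2 * d * (k + 1)) * A ^ (k + 1) := by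
    have h := pow_le_pow_left₀ hMt0 hMt (k + 1)
    have hsplit : (A * Real.exp (δ / 2 * ((D : ℝ) ^ 2 * d)) * (2 ^ d * b ^ (2 * d)) * SigD) ^ (k + 1) =
        (Real.exp (δ / 2 * ((D : ℝ) ^ 2 * d)) * 2 ^ d * SigD) ^ (k + 1) * b ^ (2 * d * (k + 1)) * A ^ (k + 1) := by
      have : A * Real.exp (δ / 2 * ((D : ℝ) ^ 2 * d)) * (2 ^ d * b ^ (2 * d)) * SigD =
          (Real.exp (δ / 2 * ((D : ℝ) ^ 2 * d)) * 2 ^ d * SigD) * (b ^ (2 * d) * A) := by ring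
      rw [this]
      ring
    rw [hsplit] at h
    exact h
  have hreg' : b₀ ≤ b → M * b ^ (3 / 2 : ℝ) ≤ (v : ℝ) + 1 := fun h => (hreg h).trans (by linarith)
  have hatom := decay_atom_le_snd (A := A) (b := b) (b₀ := b₀) (ρ₃ := ρ₃) (ρ₄ := ρ₄)
    (C := 2 ^ ((k + 1) * D) * 2 ^ 2 ^ ((k + 1) * D) * CK0 ^ ((k + 1) * D) *
      (Real.exp (δ / 2 * ((D : ℝ) ^ 2 * d)) * 2 ^ d * SigD) ^ (k + 1))
    (c := δ / 2) (X := (v : ℝ) + 1) (M := M) (by positivity) hA hb hb₀ hρ₃ hρ₄ (by linarith) (by positivity) hreg' hM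
    ((k + 1) * D + 2 * d * (k + 1)) (k + 1)
  calc 2 ^ ((k + 1) * D) * 2 ^ 2 ^ ((k + 1) * D) * K₀ ^ ((k + 1) * D) * Real.exp (-(δ / 2 * ((v : ℝ) + 1))) *
        (A * Real.exp (δ / 2 * ((D : ℝ) ^ 2 * d)) * ((L : ℕ) : ℝ) ^ d * Sigs) ^ (k + 1)
      ≤ 2 ^ ((k + 1) * D) * 2 ^ 2 ^ ((k + 1) * D) * (CK0 ^ ((k + 1) * D) * b ^ ((k + 1) * D)) *
          Real.exp (-(δ / 2 * ((v : ℝ) + 1))) *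
          ((Real.exp (δ / 2 * ((D : ℝ) ^ 2 * d)) * 2 ^ d * SigD) ^ (k + 1) * b ^ (2 * d * (k + 1)) * A ^ (k + 1)) := by
        gcongr
    _ = (2 ^ ((k + 1) * D) * 2 ^ 2 ^ ((k + 1) * D) * CK0 ^ ((k + 1) * D) *
          (Real.exp (δ / 2 * ((D : ℝ) ^ 2 * d)) * 2 ^ d * SigD) ^ (k + 1)) * b ^ ((k + 1) * D + 2 * d * (k + 1)) * A ^ (k + 1) *
          Real.exp (-(δ / 2 * ((v : ℝ) + 1))) := by rw [pow_add]; ring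
    _ ≤ _ := hatom

/-! ## §4  Atom (i4) with the (5.31) letter `ε₃₁` and its decay row -/

set_option maxHeartbeats 400000 in
/-- **ATOM (i4) FOR THE CLASS — the (5.31) constant `δ₃₁(k+1)` with the letters `K₀`, `ε₃₁`** (class step conj 3:
`(A·L^d·Σ₁(s))^{k+1}·2^{(k+1)D}2^{2^{(k+1)D}}·((k+1)D)·K₀^{(k+1)D}·ε₃₁`): if the class rows discharge `0 ≤ K₀ ≤ C_K0·b` and `0 ≤ ε₃₁ ≤ C_ε·b^{q_ε}·e^{−θ₁X}` for
some depth letter `X ≥ 0` with the two-regime width row `b₀ ≤ b → M·b^{3/2} ≤ X` and `ρ₃ + 1 ≤ θ₁·M` (`θ₁, C_ε ≥ 0`; for the class `X = w − v`, `θ₁` = the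
Combes–Thomas rate of the (5.31) legs, `C_ε·b^{q_ε}` from the centre profile and the volume), then with `q := 2d(k+1) + (k+1)D + q_ε`,
`C := (2^dΣ₁(D))^{k+1}·2^{(k+1)D}2^{2^{(k+1)D}}·((k+1)D)·C_K0^{(k+1)D}·C_ε`:
`δ₃₁(k+1) ≤ (C·(k+1)!·(q! + b₀^q e^{ρ₃b₀^{3/2}}))·e^{−ρ₃b^{3/2}}e^{ρ₄Ab^{ρ₃}}` in BOTH regimes (`L ≤ 2b²`, `b ≥ 1`, `ϰ ≥ 0`) — the proof of
`…LedgerDischarge.errPB_d31_le` with print's `ε₃₁` replaced by the row.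
[cite: BenfattoEtAl1978, (5.31) p.158, (C.7)–(C.8) p.165, (4.7) p.152; Balaban1985BackgroundPropagators, Sect. E p.428 (class form; ours)] -/
theorem errPB_d31_class_le {K₀ CK0 ε₃₁ Cε θ₁ X : ℝ} {qε : ℕ} (hκ : 0 ≤ κ) (hA : 0 ≤ A) (hb : 1 ≤ b) (hL : ((L : ℕ) : ℝ) ≤ 2 * b ^ 2)
    (hK₀ : 0 ≤ K₀) (hK₀b : K₀ ≤ CK0 * b) (hε0 : 0 ≤ ε₃₁) (hCε : 0 ≤ Cε) (hθ₁ : 0 ≤ θ₁) (hX : 0 ≤ X)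
    (hε : ε₃₁ ≤ Cε * b ^ qε * Real.exp (-(θ₁ * X)))
    (hb₀ : 0 ≤ b₀) (hρ₃ : 0 ≤ ρ₃) (hρ₄ : 1 ≤ ρ₄) (hreg : b₀ ≤ b → M * b ^ (3 / 2 : ℝ) ≤ X) (hM : ρ₃ + 1 ≤ θ₁ * M) (k : ℕ) :
    (A * ((L : ℕ) : ℝ) ^ d * ∑ p ∈ Finset.Icc 1 s, ((admissible p D).card : ℝ) *
          ((2 / (1 - Real.exp (-(κ / 2 / (p : ℕ) / Real.sqrt d))) * Real.exp (κ / 2 / (p : ℕ) / Real.sqrt d)) ^ d) ^ (p - 1)) ^ (k + 1) *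
      (2 ^ ((k + 1) * D) * 2 ^ 2 ^ ((k + 1) * D) * ((((k + 1) * D : ℕ) : ℝ) * K₀ ^ ((k + 1) * D) * ε₃₁)) ≤
      (((2 ^ d * ∑ p ∈ Finset.Icc 1 D, ((admissible p D).card : ℝ) *
            ((2 / (1 - Real.exp (-(κ / 2 / (p : ℕ) / Real.sqrt d))) * Real.exp (κ / 2 / (p : ℕ) / Real.sqrt d)) ^ d) ^ (p - 1)) ^ (k + 1) *
          (2 ^ ((k + 1) * D) * 2 ^ 2 ^ ((k + 1) * D)) * (((k + 1) * D : ℕ) : ℝ) * CK0 ^ ((k + 1) * D) * Cε) *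
          (k + 1).factorial * ((2 * d * (k + 1) + (k + 1) * D + qε).factorial +
            b₀ ^ (2 * d * (k + 1) + (k + 1) * D + qε) * Real.exp (ρ₃ * b₀ ^ (3 / 2 : ℝ)))) *
        (Real.exp (-(ρ₃ * b ^ (3 / 2 : ℝ))) * Real.exp (ρ₄ * A * b ^ ρ₃)) := by
  have hb0 : 0 ≤ b := zero_le_one.trans hb
  have hCK0 : 0 ≤ CK0 := by
    by_contra h
    have h' : CK0 < 0 := lt_of_not_ge h
    have : CK0 * b < 0 := mul_neg_of_neg_of_pos h' (by linarith)
    linarith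
  obtain ⟨hSig0, hSigle⟩ := sum_adm_geom_nonneg_le (X := κ / 2) (by linarith) s D d
  obtain ⟨hSigD0, -⟩ := sum_adm_geom_nonneg_le (X := κ / 2) (by linarith) D D d
  set Sigs := ∑ p ∈ Finset.Icc 1 s, ((admissible p D).card : ℝ) *
      ((2 / (1 - Real.exp (-(κ / 2 / (p : ℕ) / Real.sqrt d))) * Real.exp (κ / 2 / (p : ℕ) / Real.sqrt d)) ^ d) ^ (p - 1) with hSigs
  set SigD := ∑ p ∈ Finset.Icc 1 D, ((admissible p D).card : ℝ) *
      ((2 / (1 - Real.exp (-(κ / 2 / (p : ℕ) / Real.sqrt d))) * Real.exp (κ / 2 / (p : ℕ) / Real.sqrt d)) ^ d) ^ (p - 1) with hSigD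
  clear_value Sigs SigD
  have hK₀pow : K₀ ^ ((k + 1) * D) ≤ CK0 ^ ((k + 1) * D) * b ^ ((k + 1) * D) := by
    rw [← mul_pow]; exact pow_le_pow_left₀ hK₀ hK₀b _
  have hLd := side_pow_le hL d
  -- the mass power
  have hM1 : A * ((L : ℕ) : ℝ) ^ d * Sigs ≤ A * (2 ^ d * b ^ (2 * d)) * SigD := by gcongr
  have hM0 : 0 ≤ A * ((L : ℕ) : ℝ) ^ d * Sigs := by positivity
  have hMpow : (A * ((L : ℕ) : ℝ) ^ d * Sigs) ^ (k + 1) ≤ (2 ^ d * SigD) ^ (k + 1) * b ^ (2 * d * (k + 1)) * A ^ (k + 1) := by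
    have h := pow_le_pow_left₀ hM0 hM1 (k + 1)
    have hsplit : (A * (2 ^ d * b ^ (2 * d)) * SigD) ^ (k + 1) = (2 ^ d * SigD) ^ (k + 1) * b ^ (2 * d * (k + 1)) * A ^ (k + 1) := by
      have : A * (2 ^ d * b ^ (2 * d)) * SigD = (2 ^ d * SigD) * (b ^ (2 * d) * A) := by ring
      rw [this]
      ring
    rw [hsplit] at h
    exact h
  have hatom := decay_atom_le_snd (A := A) (b := b) (b₀ := b₀) (ρ₃ := ρ₃) (ρ₄ := ρ₄)
    (C := (2 ^ d * SigD) ^ (k + 1) * (2 ^ ((k + 1) * D) * 2 ^ 2 ^ ((k + 1) * D)) * (((k + 1) * D : ℕ) : ℝ) * CK0 ^ ((k + 1) * D) * Cε)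
    (c := θ₁) (X := X) (M := M) (by positivity) hA hb hb₀ hρ₃ hρ₄ hθ₁ hX hreg hM (2 * d * (k + 1) + (k + 1) * D + qε) (k + 1)
  have hΦ0 : 0 ≤ (2 : ℝ) ^ ((k + 1) * D) * 2 ^ 2 ^ ((k + 1) * D) := by positivity
  have hkD0 : 0 ≤ (((k + 1) * D : ℕ) : ℝ) := Nat.cast_nonneg _
  calc (A * ((L : ℕ) : ℝ) ^ d * Sigs) ^ (k + 1) *
        (2 ^ ((k + 1) * D) * 2 ^ 2 ^ ((k + 1) * D) * ((((k + 1) * D : ℕ) : ℝ) * K₀ ^ ((k + 1) * D) * ε₃₁))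
      ≤ ((2 ^ d * SigD) ^ (k + 1) * b ^ (2 * d * (k + 1)) * A ^ (k + 1)) *
        (2 ^ ((k + 1) * D) * 2 ^ 2 ^ ((k + 1) * D) * ((((k + 1) * D : ℕ) : ℝ) * (CK0 ^ ((k + 1) * D) * b ^ ((k + 1) * D)) *
          (Cε * b ^ qε * Real.exp (-(θ₁ * X))))) := by
        gcongr
    _ = ((2 ^ d * SigD) ^ (k + 1) * (2 ^ ((k + 1) * D) * 2 ^ 2 ^ ((k + 1) * D)) * (((k + 1) * D : ℕ) : ℝ) * CK0 ^ ((k + 1) * D) * Cε) *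
          b ^ (2 * d * (k + 1) + (k + 1) * D + qε) * A ^ (k + 1) * Real.exp (-(θ₁ * X)) := by rw [pow_add, pow_add]; ring
    _ ≤ _ := hatom

end Literature.MathematicalPhysics.QuantumFieldTheory.Balaban1983to89.B1Eq324BenfattoKernelSect5LedgerPerBox

end
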